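import Summits.CriticalPhenomena.PercolationContinuityZ3.Theorems.Transplant.FKConnectivityAllQForestLastFreePair
import Summits.CriticalPhenomena.PercolationContinuityZ3.Theorems.Transplant.FKConnectivityAllQForestHubPairOneClassIdentities
import HarnessLib

/-!
# The LAST-EDGE REFINEMENT of one-class hub-pair positivity: the node `HubPairLastEdgeOn` (NOT asserted) and the kernel arrow
# `HubPairLastEdgeOn V → HubPairOneClassOn V` (hence `→ AdjForestRayleighNoSqOn V`)

Support file (`--supports stmt-CriticalPhenomena-4575`), FK sub-lane `prim-bschramm-fk-1` (gen 26) of the post-continuity programme;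
builds on p205010 (kernel theorem, internal audit signed; external expert review pending).  One `@[conjecture]`-shaped counting node with
its `Pos` form (NOT asserted), no named facts, no sorries; standard axioms.  Part 2 of 2 (part 1: `…ForestLastFreePair` — existence and
uniqueness of the last free pair, fibre counts along a partition).

SETTING (memo bschramm/FROM-fk-1-g26-LAST-EDGE.md).  Fibre `(M, u₀)` (`ω ∖ M = u₀`; first class `ω ⊇ u₀`, second class `ω ∆ M ⊇ u₀`),
hub `o`, `e = ov`, `f = oy`; `χ = +1` if `e, f` lie in different classes, `−1` if in the same class.  The lineage's node (★)
`HubPairOneClassOn` (`…ForestHubPairDecomposition`, gen 25) says: on the TYPE-A colourings of a vertex `a` (`a` reachable from `o` in the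
first class, not in the second) `Σ χ ≥ 0`, i.e. `sRR + sBB ≤ dRB + dBR`; it implies the square-free adjacent forest Rayleigh node
(`adjForestRayleighNoSqOn_of_hubPairOneClass`).

THE REFINEMENT.  In a type-A colouring the first-class path from `o` to the pinned class `[a]` of `a` has a unique LAST FREE PAIR
`g = x a'` (`a' ∈ [a]`, `x ∉ [a]`); deleting `g` leaves a colouring of the fibre `(M ∖ g, u₀)` in which `x` is reachable from `o` in the
first class while `a` is reachable from `o` in NEITHER class ("`a` of type 0"), and conversely.  So the type-A sum splits as
`s_A(M,u₀; o,a) = Σ_g T(M ∖ g, u₀; o; x, a)` over the free pairs `g = x a'` entering `[a]`, with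
`T(N,u; o; x, a) := Σ_{x ∈ C_first(o), a ∉ C_first(o) ∪ C_second(o)} χ`.
* **`HubPairLastEdgeOn V`** (NOT asserted): `T ≥ 0` on every fibre, all `o, v ≠ y, x, a` — as four fibre counts,
  `#(Fo∩{e,f}∩R_ox∩R_oaᶜ, Fo∩R_oaᶜ) + #(Fo∩R_ox∩R_oaᶜ, Fo∩{e,f}∩R_oaᶜ) ≤ #(Fo∩{e}∩R_ox∩R_oaᶜ, Fo∩{f}∩R_oaᶜ) + #(Fo∩{f}∩R_ox∩R_oaᶜ, Fo∩{e}∩R_oaᶜ)`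
  (`R_oz = {o ~ z}`).  EVIDENCE (gen 26, exact, exhaustive; two independent engines work/eng.py (Python) and work/g26t.c (C) agree on
  n ≤ 7): 0 failures over every connected simple graph with ≤ 8 vertices, every `(o, e, f)` and every ordered pair `(x, a)`
  (6,424,782 cells at n = 8; 384,480 at n = 7), over 400 random multigraphs with parallel pairs (89,272 cells), and in the direct
  last-edge form (Σ over type-A colourings whose path ends with a prescribed pair) 0 / 66,690 at n = 7.  By contrast the FIRST-edge
  refinement is false (41,392 negative cells of 243,635 at n = 7), and so are the two-vertex conditionings `[x, a ∈ C_first(o)]`,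
  `[x, a ∉ C_first(o)]` and `[x ∈ C_first(o) ∖ C_second(o)][a of type 0]` (memo §1 has the full 9 × 9 literal table).
* `lastEdge_term_eq` (deleting the last pair turns the restricted type-A counts into the `T`-counts of `(M ∖ g, u₀)`),
  **`lastEdge_decomposition`** (type-A count = Σ over the free pairs entering `[a]` of `T`-counts; part 1 supplies existence/uniqueness of
  the last free pair and `fibreCount_eq_sum_of_partition`), `typeA_count_eq_zero_of_pinned` / `hubPairOneClass_of_pinned_to_v` (the
  vertices pinned to `o`, `v`, `y`);
* **`hubPairOneClassOn_of_lastEdge : HubPairLastEdgeOn V → HubPairOneClassOn V`**, **`adjForestRayleighNoSqOn_of_lastEdge`**,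
  **`adjForestRayleighNoSqPos_of_lastEdgePos`**.
So the square-free adjacent forest Rayleigh node — adjacent-edge negative correlation of the arboreal gas on every finite graph — follows
from the positivity of the finest atoms found so far: one pair `(x, a)` with `x` in and `a` doubly out of the clusters of the hub.
[cite: SempleWelsh2008, Conj. 1.1 (p. 2); Thm. 4.2 (p. 11)] [cite: Linusson2011, Prop. 2.6] [cite: Grimmett2006, §1.5 (p. 13)]
-/

noncomputable section

namespace Summit.CriticalPhenomena.PercolationContinuityZ3.Theorems
namespace FK

open Set Literature.Probability.LatticeModels Literature.Probability.Percolation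
open scoped Classical symmDiff

variable {V : Type*} [Fintype V]

/-- **LAST-EDGE (ENTRY-PAIR) POSITIVITY on the vertex type `V`**: for every fibre `(M, u₀)`, all `o`, `v ≠ y`, and all vertices `x, a`,
among the colourings in which `x` is reachable from `o` in the first class and `a` is reachable from `o` in NEITHER class:
`#(e,f ∈ first) + #(e,f ∈ second) ≤ #(e ∈ first, f ∈ second) + #(f ∈ first, e ∈ second)` (`e = ov`, `f = oy`).
CONJECTURE-SHAPED COUNTING STATEMENT, NOT asserted. [cite: SempleWelsh2008, Conj. 1.1 (p. 2)] [cite: Linusson2011, Prop. 2.6] -/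
def HubPairLastEdgeOn (V : Type*) [Fintype V] : Prop :=
  ∀ (M u₀ : BondConfig V), Disjoint u₀ M → ∀ (o v y x a : V), v ≠ y →
    fibreCount M u₀ (forestEv V ∩ {ω | s(o, v) ∈ ω ∧ s(o, y) ∈ ω} ∩ reachEv o x ∩ (reachEv o a)ᶜ) (forestEv V ∩ (reachEv o a)ᶜ) +
        fibreCount M u₀ (forestEv V ∩ reachEv o x ∩ (reachEv o a)ᶜ) (forestEv V ∩ {ω | s(o, v) ∈ ω ∧ s(o, y) ∈ ω} ∩ (reachEv o a)ᶜ) ≤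
      fibreCount M u₀ (forestEv V ∩ {ω | s(o, v) ∈ ω} ∩ reachEv o x ∩ (reachEv o a)ᶜ) (forestEv V ∩ {ω | s(o, y) ∈ ω} ∩ (reachEv o a)ᶜ) +
        fibreCount M u₀ (forestEv V ∩ {ω | s(o, y) ∈ ω} ∩ reachEv o x ∩ (reachEv o a)ᶜ) (forestEv V ∩ {ω | s(o, v) ∈ ω} ∩ (reachEv o a)ᶜ)

/-- **Last-edge positivity on every finite vertex type.**  CONJECTURE-SHAPED, NOT asserted (evidence in the module docstring: every
connected simple graph with ≤ 8 vertices, every `(x, a)`; random multigraphs). [cite: SempleWelsh2008, Conj. 1.1 (p. 2); Thm. 4.2 (p. 11)] -/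
@[conjecture] def HubPairLastEdgePos : Prop := ∀ n : ℕ, HubPairLastEdgeOn (Fin n)

/-! ### The last-edge decomposition of the type-A counts -/

section Decomposition

variable {M u₀ : BondConfig V} {o v y a : V} (hd : Disjoint u₀ M)
  (hao : ¬ (openGraph u₀).Reachable a o) (hav : ¬ (openGraph u₀).Reachable a v) (hay : ¬ (openGraph u₀).Reachable a y)
  {P Q : Set (BondConfig V)}
  (hP : ∀ (g : Sym2 V) (ω : BondConfig V), g ≠ s(o, v) → g ≠ s(o, y) → g ∉ ω → (insert g ω ∈ P ↔ ω ∈ P))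
include hd hao hav hay hP

/-- **Deleting the last pair.**  For a free pair `g = s(x, a')` with `a'` in the pinned class of `a` and `x` outside it, the type-A
counts restricted to "`g` is the last free pair" are the `T`-counts of the fibre `(M ∖ g, u₀)` at `(o; x, a)`. [cite: Linusson2011, Prop. 2.6] -/
theorem lastEdge_term_eq {x a' : V} (hgM : s(x, a') ∈ M) (haa' : (openGraph u₀).Reachable a a') (hax : ¬ (openGraph u₀).Reachable a x) :
    fibreCount M u₀ (forestEv V ∩ P ∩ reachEv o a ∩ {ω | s(x, a') ∈ ω ∧ (openGraph (ω \ {s(x, a')})).Reachable o x})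
        (forestEv V ∩ Q ∩ (reachEv o a)ᶜ) =
      fibreCount (M \ {s(x, a')}) u₀ (forestEv V ∩ P ∩ reachEv o x ∩ (reachEv o a)ᶜ) (forestEv V ∩ Q ∩ (reachEv o a)ᶜ) := by
  set g := s(x, a') with hgdef
  have hxa' : x ≠ a' := fun h => hax (h ▸ haa')
  have hge : g ≠ s(o, v) := by
    intro h'
    rcases Sym2.eq_iff.1 h' with ⟨h1, h2⟩ | ⟨h1, h2⟩
    · exact hav (h2 ▸ haa')
    · exact hao (h2 ▸ haa')
  have hgf : g ≠ s(o, y) := by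
    intro h'
    rcases Sym2.eq_iff.1 h' with ⟨h1, h2⟩ | ⟨h1, h2⟩
    · exact hay (h2 ▸ haa')
    · exact hao (h2 ▸ haa')
  set N := M \ {g} with hNdef
  have hgN : g ∉ N := fun h' => h'.2 rfl
  have hgu : g ∉ u₀ := fun h' => hd.le_bot ⟨h', hgM⟩
  have hMN : M = insert g N := by rw [hNdef, insert_sdiff_singleton, insert_eq_of_mem hgM]
  have hdN : Disjoint u₀ N := hd.mono_right Set.sdiff_subset
  rw [hMN, fibreCount_insert_one hgN]
  -- the summand with `g` in the second class vanishes (`L` asks for `g` in the first class)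
  have h0 : fibreCount N u₀ ({ω | g ∉ ω} ∩ (forestEv V ∩ P ∩ reachEv o a ∩ {ω | g ∈ ω ∧ (openGraph (ω \ {g})).Reachable o x}))
      ({ω | g ∉ ω} ∩ {ω | insert g ω ∈ forestEv V ∩ Q ∩ (reachEv o a)ᶜ}) = 0 :=
    fibreCount_eq_zero_of_forall _ _ _ _ fun ω _ hA _ => hA.1 hA.2.2.1
  rw [h0, add_zero]
  refine fibreCount_congr_fibre N u₀ fun ω hω => ?_
  have hno := notMem_and_notMem_symmDiff_of_fibre hgN hgu hω
  have hsub : u₀ ⊆ ω := fun r hr => (show r ∈ ω \ N by rw [hω]; exact hr).1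
  have hins : insert g ω \ {g} = ω := insert_sdiff_self_of_notMem hno.1
  have hF := insert_mem_forestEv_iff hxa' hno.1 (V := V)
  simp only [mem_inter_iff, mem_setOf_eq, mem_compl_iff, mem_reachEv, mem_insert_iff, true_or, true_and, hins]
  constructor
  · rintro ⟨⟨-, ⟨⟨hFo, hPω⟩, -⟩, hox⟩, hB⟩
    rw [hF] at hFo
    refine ⟨⟨⟨⟨hFo.1, (hP g ω hge hgf hno.1).1 hPω⟩, hox⟩, fun hoa => hFo.2 ?_⟩, hB.2⟩
    exact (hox.symm.trans hoa).trans (haa'.mono (openGraph_mono hsub))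
  · rintro ⟨⟨⟨⟨hFo, hPω⟩, hox⟩, hoa⟩, hB⟩
    have hxa'' : ¬ (openGraph ω).Reachable x a' := fun h' =>
      hoa ((hox.trans h').trans (haa'.mono (openGraph_mono hsub)).symm)
    refine ⟨⟨hno.1, ⟨⟨hF.2 ⟨hFo, hxa''⟩, (hP g ω hge hgf hno.1).2 hPω⟩, ?_⟩, hox⟩, hno.2, hB⟩
    -- `o ~ x – a' ~ a` in `insert g ω`
    have h1 : (openGraph (insert g ω)).Reachable o x := hox.mono (openGraph_mono (subset_insert _ _))
    have h2 : (openGraph (insert g ω)).Adj x a' := (openGraph_adj _ x a').2 ⟨mem_insert _ _, hxa'⟩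
    have h3 : (openGraph (insert g ω)).Reachable a' a :=
      (haa'.mono (openGraph_mono (hsub.trans (subset_insert _ _)))).symm
    exact (h1.trans h2.reachable).trans h3

/-- **THE LAST-EDGE DECOMPOSITION**: a type-A count on `(M, u₀)` is the sum, over the free pairs `s(x, a')` entering the pinned class of
`a`, of the `T`-counts of `(M ∖ s(x,a'), u₀)` at `(o; x, a)`. [cite: Linusson2011, Prop. 2.6] [cite: Grimmett2006, §1.5 (p. 13)] -/
theorem lastEdge_decomposition :
    fibreCount M u₀ (forestEv V ∩ P ∩ reachEv o a) (forestEv V ∩ Q ∩ (reachEv o a)ᶜ) =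
      ∑ i ∈ (Finset.univ.filter fun i : V × V =>
          s(i.1, i.2) ∈ M ∧ (openGraph u₀).Reachable a i.2 ∧ ¬ (openGraph u₀).Reachable a i.1),
        fibreCount (M \ {s(i.1, i.2)}) u₀ (forestEv V ∩ P ∩ reachEv o i.1 ∩ (reachEv o a)ᶜ) (forestEv V ∩ Q ∩ (reachEv o a)ᶜ) := by
  set I := (Finset.univ.filter fun i : V × V =>
    s(i.1, i.2) ∈ M ∧ (openGraph u₀).Reachable a i.2 ∧ ¬ (openGraph u₀).Reachable a i.1) with hI
  set L : V × V → Set (BondConfig V) := fun i => {ω | s(i.1, i.2) ∈ ω ∧ (openGraph (ω \ {s(i.1, i.2)})).Reachable o i.1} with hL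
  rw [fibreCount_eq_sum_of_partition I L M u₀ (forestEv V ∩ P ∩ reachEv o a) (forestEv V ∩ Q ∩ (reachEv o a)ᶜ)]
  · refine Finset.sum_congr rfl fun i hi => ?_
    obtain ⟨hgM, haa', hax⟩ := (Finset.mem_filter.1 hi).2
    exact lastEdge_term_eq hd hao hav hay hP hgM haa' hax
  · -- cover: the last free pair exists
    intro ω hω hA hB
    have hsub : u₀ ⊆ ω := fun r hr => (show r ∈ ω \ M by rw [hω]; exact hr).1
    have hsub' : u₀ ⊆ ω ∆ M := fun r hr => Set.mem_symmDiff.2 (Or.inl ⟨hsub hr, fun hrM => hd.le_bot ⟨hr, hrM⟩⟩)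
    have hωM : ω ⊆ M ∪ u₀ := (subset_union_of_fibre hω).1
    have hnot : ¬ (openGraph u₀).Reachable o a := fun h' => hB.2 (h'.mono (openGraph_mono hsub'))
    obtain ⟨x, a', hxω, hxM, haa', hax, hox⟩ := exists_last_free_pair (M := M) _ ω o rfl hsub hωM hA.1.1 hA.2 hnot
    exact ⟨(x, a'), Finset.mem_filter.2 ⟨Finset.mem_univ _, hxM, haa', hax⟩, hxω, hox⟩
  · -- uniqueness of the last free pair
    intro ω hω hA _ i hi j hj hLi hLj
    have hsub : u₀ ⊆ ω := fun r hr => (show r ∈ ω \ M by rw [hω]; exact hr).1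
    obtain ⟨-, hai, hxi⟩ := (Finset.mem_filter.1 hi).2
    obtain ⟨-, haj, hxj⟩ := (Finset.mem_filter.1 hj).2
    obtain ⟨h1, h2⟩ := last_free_pair_unique hsub hA.1.1 hLi.1 hLj.1 hai haj hxi hxj hLi.2 hLj.2
    exact Prod.ext h1 h2

end Decomposition

/-! ### (T) ⇒ (★) ⇒ the node -/

section Main

variable {M u₀ : BondConfig V} {o v y a : V}

omit [Fintype V] in
/-- The pinned pairs lie in every configuration of the fibre and in every partner. [folklore] -/
theorem pinned_subset_both (hd : Disjoint u₀ M) {ω : BondConfig V} (hω : ω \ M = u₀) : u₀ ⊆ ω ∧ u₀ ⊆ ω ∆ M := by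
  have hsub : u₀ ⊆ ω := fun r hr => (show r ∈ ω \ M by rw [hω]; exact hr).1
  exact ⟨hsub, fun r hr => Set.mem_symmDiff.2 (Or.inl ⟨hsub hr, fun hrM => hd.le_bot ⟨hr, hrM⟩⟩)⟩

/-- If the second class always joins `o` to `a` on the fibre (e.g. `a` pinned to `o`), the type-A counts vanish. [cite: Linusson2011, Prop. 2.6] -/
theorem typeA_count_eq_zero_of_pinned (hd : Disjoint u₀ M) (hoa : (openGraph u₀).Reachable a o) (P Q : Set (BondConfig V)) :
    fibreCount M u₀ (P ∩ reachEv o a) (Q ∩ (reachEv o a)ᶜ) = 0 :=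
  fibreCount_eq_zero_of_forall _ _ _ _ fun _ hω _ hB => hB.2 (hoa.symm.mono (openGraph_mono (pinned_subset_both hd hω).2))

/-- (★) at a vertex `a` PINNED TO `v`: transport of `hubPairOneClass_at_v` along the pinned pairs (with its degenerate cases).
[cite: SempleWelsh2008, Conj. 1.1 (p. 2)] [cite: Linusson2011, Prop. 2.6] -/
theorem hubPairOneClass_of_pinned_to_v (hd : Disjoint u₀ M) (hvy : v ≠ y) (hav : (openGraph u₀).Reachable a v) :
    fibreCount M u₀ (forestEv V ∩ {ω | s(o, v) ∈ ω ∧ s(o, y) ∈ ω} ∩ reachEv o a) (forestEv V ∩ (reachEv o a)ᶜ) +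
        fibreCount M u₀ (forestEv V ∩ reachEv o a) (forestEv V ∩ {ω | s(o, v) ∈ ω ∧ s(o, y) ∈ ω} ∩ (reachEv o a)ᶜ) ≤
      fibreCount M u₀ (forestEv V ∩ {ω | s(o, v) ∈ ω} ∩ reachEv o a) (forestEv V ∩ {ω | s(o, y) ∈ ω} ∩ (reachEv o a)ᶜ) +
        fibreCount M u₀ (forestEv V ∩ {ω | s(o, y) ∈ ω} ∩ reachEv o a) (forestEv V ∩ {ω | s(o, v) ∈ ω} ∩ (reachEv o a)ᶜ) := by
  by_cases hov : o = v
  · subst hov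
    rw [fibreCount_eq_zero_of_forall _ _ _ _ fun ω _ hA _ => hA.1.1.1 _ hA.1.2.1 (Sym2.mk_isDiag_iff.2 rfl),
      fibreCount_eq_zero_of_forall _ _ _ _ fun ω _ _ hB => hB.1.1.1 _ hB.1.2.1 (Sym2.mk_isDiag_iff.2 rfl)]
    exact Nat.zero_le _
  by_cases heM : s(o, v) ∈ M
  · -- transport `reachEv o a ↔ {o ~ v}` on the fibre, then `hubPairOneClass_at_v`
    have htr : ∀ (P Q : Set (BondConfig V)), fibreCount M u₀ (P ∩ reachEv o a) (Q ∩ (reachEv o a)ᶜ) =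
        fibreCount M u₀ (P ∩ {ω | (openGraph ω).Reachable o v}) (Q ∩ {ζ | ¬ (openGraph ζ).Reachable o v}) := by
      intro P Q
      refine fibreCount_congr_fibre M u₀ fun ω hω => ?_
      obtain ⟨h1, h2⟩ := pinned_subset_both hd hω
      have e1 : (openGraph ω).Reachable o a ↔ (openGraph ω).Reachable o v :=
        ⟨fun h => h.trans (hav.mono (openGraph_mono h1)), fun h => h.trans (hav.mono (openGraph_mono h1)).symm⟩
      have e2 : (openGraph (ω ∆ M)).Reachable o a ↔ (openGraph (ω ∆ M)).Reachable o v :=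
        ⟨fun h => h.trans (hav.mono (openGraph_mono h2)), fun h => h.trans (hav.mono (openGraph_mono h2)).symm⟩
      simp only [mem_inter_iff, mem_compl_iff, mem_reachEv, mem_setOf_eq, e1, e2]
    rw [htr, htr, htr, htr]
    exact (hubPairOneClass_at_v hd hov hvy heM).le
  · by_cases heu : s(o, v) ∈ u₀
    · -- `e` pinned: the second class joins `o` to `v ~ a`
      have hz : ∀ (P Q : Set (BondConfig V)), fibreCount M u₀ (P ∩ reachEv o a) (Q ∩ (reachEv o a)ᶜ) = 0 := by
        intro P Q
        refine fibreCount_eq_zero_of_forall _ _ _ _ fun ω hω _ hB => hB.2 ?_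
        obtain ⟨-, h2⟩ := pinned_subset_both hd hω
        exact ((openGraph_adj _ o v).2 ⟨h2 heu, hov⟩).reachable.trans (hav.mono (openGraph_mono h2)).symm
      rw [hz, hz]; exact Nat.zero_le _
    · -- `e` absent: it lies in no class
      rw [fibreCount_eq_zero_of_forall _ _ _ _ fun ω hω hA _ => (notMem_and_notMem_symmDiff_of_fibre heM heu hω).1 hA.1.2.1,
        fibreCount_eq_zero_of_forall _ _ _ _ fun ω hω _ hB => (notMem_and_notMem_symmDiff_of_fibre heM heu hω).2 hB.1.2.1]
      exact Nat.zero_le _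

omit [Fintype V] in
/-- Membership events of `e`, `f` are insensitive to inserting a third pair. [folklore] -/
theorem insert_mem_pairEvents_iff {e f g : Sym2 V} {ω : BondConfig V} (hge : g ≠ e) (hgf : g ≠ f) (_hg : g ∉ ω) :
    (insert g ω ∈ {ω : BondConfig V | e ∈ ω ∧ f ∈ ω} ↔ ω ∈ {ω : BondConfig V | e ∈ ω ∧ f ∈ ω}) ∧
      (insert g ω ∈ {ω : BondConfig V | e ∈ ω} ↔ ω ∈ {ω : BondConfig V | e ∈ ω}) ∧
      (insert g ω ∈ {ω : BondConfig V | f ∈ ω} ↔ ω ∈ {ω : BondConfig V | f ∈ ω}) := by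
  simp only [mem_setOf_eq, mem_insert_iff]
  refine ⟨⟨?_, ?_⟩, ⟨?_, Or.inr⟩, ⟨?_, Or.inr⟩⟩
  · rintro ⟨h1 | h1, h2 | h2⟩
    · exact absurd h1.symm hge
    · exact absurd h1.symm hge
    · exact absurd h2.symm hgf
    · exact ⟨h1, h2⟩
  · rintro ⟨h1, h2⟩; exact ⟨Or.inr h1, Or.inr h2⟩
  · exact fun h1 => h1.resolve_left fun h' => hge h'.symm
  · exact fun h1 => h1.resolve_left fun h' => hgf h'.symm

/-- **LAST-EDGE POSITIVITY ⇒ ONE-CLASS HUB-PAIR POSITIVITY (★).**  Decompose the type-A counts along the last free pair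
(`lastEdge_decomposition`) and add the `T`-inequalities of the fibres `(M ∖ g, u₀)`; the vertices pinned to `o`, `v`, `y` are the
degenerate cases `typeA_count_eq_zero_of_pinned` / `hubPairOneClass_of_pinned_to_v`.
[cite: SempleWelsh2008, Conj. 1.1 (p. 2); Thm. 4.2 (p. 11)] [cite: Linusson2011, Prop. 2.6] -/
theorem hubPairOneClassOn_of_lastEdge (h : HubPairLastEdgeOn V) : HubPairOneClassOn V := by
  intro M u₀ hd o v y a hvy
  by_cases hoa : (openGraph u₀).Reachable a o
  · rw [typeA_count_eq_zero_of_pinned hd hoa, typeA_count_eq_zero_of_pinned hd hoa]; exact Nat.zero_le _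
  by_cases hav : (openGraph u₀).Reachable a v
  · exact hubPairOneClass_of_pinned_to_v hd hvy hav
  by_cases hay : (openGraph u₀).Reachable a y
  · have key := hubPairOneClass_of_pinned_to_v (o := o) hd hvy.symm hay
    have hEF : {ω : BondConfig V | s(o, y) ∈ ω ∧ s(o, v) ∈ ω} = {ω | s(o, v) ∈ ω ∧ s(o, y) ∈ ω} := by
      ext ω; simp only [mem_setOf_eq]; exact and_comm
    rw [hEF] at key
    omega
  -- main case: decompose along the last free pair entering the pinned class of `a`
  have hP1 : ∀ (g : Sym2 V) (ω : BondConfig V), g ≠ s(o, v) → g ≠ s(o, y) → g ∉ ω →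
      (insert g ω ∈ {ω : BondConfig V | s(o, v) ∈ ω ∧ s(o, y) ∈ ω} ↔ ω ∈ {ω : BondConfig V | s(o, v) ∈ ω ∧ s(o, y) ∈ ω}) :=
    fun g ω hge hgf hg => (insert_mem_pairEvents_iff hge hgf hg).1
  have hP2 : ∀ (g : Sym2 V) (ω : BondConfig V), g ≠ s(o, v) → g ≠ s(o, y) → g ∉ ω →
      (insert g ω ∈ {ω : BondConfig V | s(o, v) ∈ ω} ↔ ω ∈ {ω : BondConfig V | s(o, v) ∈ ω}) :=
    fun g ω hge hgf hg => (insert_mem_pairEvents_iff hge hgf hg).2.1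
  have hP3 : ∀ (g : Sym2 V) (ω : BondConfig V), g ≠ s(o, v) → g ≠ s(o, y) → g ∉ ω →
      (insert g ω ∈ {ω : BondConfig V | s(o, y) ∈ ω} ↔ ω ∈ {ω : BondConfig V | s(o, y) ∈ ω}) :=
    fun g ω hge hgf hg => (insert_mem_pairEvents_iff hge hgf hg).2.2
  have hP0 : ∀ (g : Sym2 V) (ω : BondConfig V), g ≠ s(o, v) → g ≠ s(o, y) → g ∉ ω →
      (insert g ω ∈ (univ : Set (BondConfig V)) ↔ ω ∈ (univ : Set (BondConfig V))) := fun _ _ _ _ _ => by simp only [mem_univ]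
  have e1 : forestEv V ∩ (reachEv o a)ᶜ = forestEv V ∩ univ ∩ (reachEv o a)ᶜ := by rw [inter_univ]
  have e2 : forestEv V ∩ reachEv o a = forestEv V ∩ univ ∩ reachEv o a := by rw [inter_univ]
  rw [e1, e2, lastEdge_decomposition hd hoa hav hay hP1, lastEdge_decomposition hd hoa hav hay hP0,
    lastEdge_decomposition hd hoa hav hay hP2, lastEdge_decomposition hd hoa hav hay hP3, ← Finset.sum_add_distrib,
    ← Finset.sum_add_distrib]
  refine Finset.sum_le_sum fun i _ => ?_
  have key := h (M \ {s(i.1, i.2)}) u₀ (hd.mono_right Set.sdiff_subset) o v y i.1 a hvy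
  simp only [inter_univ] at key ⊢
  exact key

/-- **`HubPairLastEdgeOn V → AdjForestRayleighNoSqOn V`**: last-edge positivity implies the square-free adjacent forest Rayleigh node
(through (★), `adjForestRayleighNoSqOn_of_hubPairOneClass`). [cite: SempleWelsh2008, Conj. 1.1 (p. 2); Thm. 4.2 (p. 11)]
[cite: Linusson2011, Prop. 2.6] -/
theorem adjForestRayleighNoSqOn_of_lastEdge (h : HubPairLastEdgeOn V) : AdjForestRayleighNoSqOn V :=
  adjForestRayleighNoSqOn_of_hubPairOneClass (hubPairOneClassOn_of_lastEdge h)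

/-- **`HubPairLastEdgePos → AdjForestRayleighNoSqPos`** (hence adjacent-edge negative correlation of the arboreal gas on every finite
graph, `ag_adjacent_negCorr_of_adjForestNoSq`). [cite: SempleWelsh2008, Conj. 1.1 (p. 2)] [cite: Grimmett2006, §1.5 (p. 13)] -/
theorem adjForestRayleighNoSqPos_of_lastEdgePos (h : HubPairLastEdgePos) : AdjForestRayleighNoSqPos :=
  fun n => adjForestRayleighNoSqOn_of_lastEdge (h n)

end Main

end FK
end Summit.CriticalPhenomena.PercolationContinuityZ3.Theorems

end
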